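import Summits.BirchSwinnertonDyer.BirchSwinnertonDyer.Theorems.SmallImageMuTransferMuTransferX9CoreAssemblyOdd
import Summits.BirchSwinnertonDyer.BirchSwinnertonDyer.Theorems.OneSidedTwistSqueezeX9KatoDivisibilityX9GradedCoreAlgebra
import Summits.BirchSwinnertonDyer.Rank1Residual.SmallImageMu.GradedEulerLossCore
import Literature.NumberTheory.EllipticCurves.IwasawaTwistModPk
import HarnessLib

set_option autoImplicit false

-- the summit and its single problem are both named `BirchSwinnertonDyer` (registry layout D-0017)
set_option linter.dupNamespace false

/-!
# The GRADED core assembly: `SIM.FineCoreGradedOddPrime` (depth of the fine Selmer group ≤ Euler loss, every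
# level `n`) from THREE graded stubs over the level-`p^{d+1}` carrier `𝒯_J^{(d+1)} = E[p^{d+1}] ⊗ (ℤ/p^{d+1})[T]/T^J`
# (T-es-6 (a), `IwasawaTwistModPk`, p618074) — kernel-checked port of `CoreAssembly.coreOdd_of_selmerDual_of_stepsTwoFour`

Seat `bsd-line-k6-p4` (prover-bsd-line-k6-p4-g4-0, 4th LEAD on crux stmt-BirchSwinnertonDyer-20547 `KatoDivisibilityX9`,
line of record `Cruxes/KatoDivisibilityX9/Lines/graded_euler_loss.lean`, depth stub `stub_depthCoreX9 :
SIM.FineCoreGradedOddPrime`).  THEOREMS ONLY, sorry-free, no definition, nothing asserted about any curve: the three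
graded statements enter as HYPOTHESES, stated verbatim (they are the stubs hG1ᵍ / S1+S2 / hG34ᵍ of MEMO-es §15/§25.2,
cell `bsd-f3-mu`), exactly as `…X9CoreAssemblyOdd` did at `n = 0` with `stub_selmerDualOdd` / `stub_stepsTwoFourOdd`.
`--supports stmt-BirchSwinnertonDyer-20547`.

THE PORT (MEMO-es §15, §25.2; what changes w.r.t. `n = 0`).  Given a genuine Euler-system class `s ∉ p^{n+1}𝐇¹`, write
`s = p^d·s'` with `d ≤ n`, `s' ∉ p𝐇¹` (`GradedCoreAlgebra.exists_eq_C_pow_smul_and_not_mem`; `s'` carries the transverse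
VALUE through `red_Ω s' = T^a κ'`, it is never used as an Euler system).  Test pairs are `(y, t)` with `ι_N y = p^d·t`,
`t ∈ Sel₀(ℚ_∞, E[p^∞])`.  Then, with `e = p^N` large:
* **hG1ᵍ (`hG1`, Selmer side at level `p^{d+1}`)**: `(y, J)` with `T^J y ≠ 0` ↦ a class
  `Ψ ∈ H¹(ℚ, 𝒯^{(d+1)}_{J+1}(E, κ⁻¹))` and a mod-`p` class `ψ̄ ∈ H¹(ℚ, 𝒯_{J+1}(E[p], κ⁻¹))` with `p^d·Ψ = ι_*ψ̄`
  (`ι : E[p] ⊂ E[p^{d+1}]`, any equivariant map inducing the inclusion of points), `T^J ψ̄ ≠ 0`, `Ψ` unramified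
  outside `S ⊇ S₀` and `loc_v(T^ε Ψ) = 0` for `v ∈ S` (`ε = ε_d` fixed before `J`).
* **S1+S2ᵍ (`h12`, test pair ↦ Kolyvagin prime; Lemma 5.7.B WITH DEFECT `c₀` + Chebotarev at `p`-level `d+1`)**:
  constants `c₀, N₁` (depending on the pair and `d` only) such that for `N ≥ N₁`, `e = p^N`, the level-`e` classes
  `φ` (of `κ'_e`) and `ψ` (`T^{e−1}ψ ≠ 0`) admit an arithmetic Frobenius `Fr` at a prime `q ∉ S` with
  `ρ_{E,p^{d+1}}(Fr) = 1`, `Fr ∈ Gal(ℚ̄/ℚ_N) ∖ Gal(ℚ̄/ℚ_{N+1})` and a convolution coefficient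
  `C_j(φ(Fr), ψ(Fr)) ≠ 0` for some `j ≤ c₀ + 1` (Weil pairing `e_p`).
* **hG34ᵍ (`hG34`, Kolyvagin class and reciprocity over `A = Λ/(p^{d+1}, ω²)`, transfer of `p^d` to the test
  side)**: for such `Fr`, and the test class taken at T6a-level `L = 2e(d+1)` (so that it PROJECTS to the
  `ω²`-carrier, `T^{2e(d+1)} ∈ (p^{d+1}, ω²)`; its mod-`p` partner truncated to level `2e` for the count), a unit `U`
  with `C_i(U(S)·S^{e+a}Φ(Fr), ψ̄(Fr)) = 0` for all `i + ε < 2e` — the SAME mod-`p` conclusion as `stub_stepsTwoFourOdd`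
  (the ω²-carrier and the level-`p^{d+1}` pairings are internal to its proof: T-es-6 (b)/(d)).
* the COUNT with defect (`GradedCoreAlgebra.convCoeff_eq_zero_of_reciprocity_le`, `r = c₀ + 1`,
  `e > a + ε + c₀ + 1`) and truncation-invariance of `C_j`, `j < e` ⟹ contradiction.
The published inputs `hred` (Kato §13.8, F2), `hPT` (Poitou–Tate over `ℚ`), `hEP` (local Euler–Poincaré) are the
`n = 0` ones (all tree theorems; discharged in the line file, not here).

HONEST LABEL: the three graded statements are OPEN (typed here for the first time, over tree declarations only);
nothing is proved about them; `SIM.FineCoreGradedOddPrime` (hence ES-C4) follows from them by this file; crux 20547 /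
B2 untouched; beyond-print theorem toward BSD: NO; BSD is not proved by any of this.

References: K. Kato, Astérisque 295 (2004) §13.3, §13.8, Thm. 12.4, Thm. 13.4 [Kato2004Asterisque]; B. Mazur, K. Rubin,
Mem. AMS 799 (2004) Prop. 1.3.2, §4.4, §5.3 [MazurRubin2004]; J. S. Milne, ADT I 2.8, 4.10 [MilneADT2006];
HOME/MEMO-es.md §15, §21, §25.2–25.3, §25.7.
-/

noncomputable section

open scoped Classical NumberField ContRepresentation
open WeierstrassCurve Field IsDedekindDomain
open Literature.NumberTheory.GaloisRepresentations
open Literature.NumberTheory.GaloisCohomology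
open Literature.NumberTheory.EllipticCurves
open Literature.NumberTheory.EllipticCurves.Kato2004
open Literature.NumberTheory.EllipticCurves.Kato2004.EulerSystemValues
open Summit.BirchSwinnertonDyer.BirchSwinnertonDyer.Rank1Residual
open Summit.BirchSwinnertonDyer.BirchSwinnertonDyer.Rank1Residual.CoreAssembly
open Summit.BirchSwinnertonDyer.BirchSwinnertonDyer.Theorems.OneSidedTwistSqueezeX9KatoDivisibilityX9GradedCoreAlgebra
open Summit.BirchSwinnertonDyer.Rank1Residual.SmallImageMu (FineCoreGradedOddPrime)

namespace Summit.BirchSwinnertonDyer.BirchSwinnertonDyer.Theorems.OneSidedTwistSqueezeX9KatoDivisibilityX9GradedCoreAssembly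

/-- **The graded core `SIM.FineCoreGradedOddPrime` from the three graded stubs and three published facts**
(`hred`: Kato §13.8; `hPT`: Poitou–Tate over `ℚ`; `hEP`: local Euler–Poincaré characteristic; `hG1`: the level-`p^{d+1}`
test cocycle; `h12`: Lemma 5.7.B with defect + Chebotarev at `p`-level `d+1`; `hG34`: Kolyvagin class + reciprocity
over `Λ/(p^{d+1}, ω²)` with its mod-`p` output).  Proof = the `n = 0` kernel composition
`CoreAssembly.coreOdd_of_selmerDual_of_stepsTwoFour` with `s'` (`s = p^d s'`) carrying the transverse value, the
mod-`p` class `ψ̄` in the roles of `Ψ` at STEP 1/2 and in the count, and `Ψ` (level `p^{d+1}`) threaded from `hG1` to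
`hG34`. [cite: Kato2004Asterisque, §13.3 and Thm. 12.4] [cite: MazurRubin2004, Prop. 1.3.2, §4.4, §5.3] -/
theorem fineCoreGraded_of_testCocycle_of_kolyvaginPrime_of_reciprocity (hred : mem_pSmul_of_red_eq_zero)
    (hPT : poitouTate_sum_localTatePairing_eq_zero ℚ)
    (hEP : ∀ v : HeightOneSpectrum (𝓞 ℚ), localEulerPoincareCharacteristic (v.adicCompletion ℚ))
    (hG1 : ∀ (W : WeierstrassCurve ℚ) [W.IsElliptic] [W.IsGloballyMinimal] (p : ℕ) [Fact p.Prime]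
      (κ : ZpExtension ℚ p) (γ : absoluteGaloisGroup ℚ),
      p ≠ 2 → W.HasIrreducibleModPGaloisRep p → ¬ W.HasSurjectiveModNGaloisRep p →
      κ.IsCyclotomic → κ.IsTopGenerator γ →
      (∀ v : HeightOneSpectrum (𝓞 ℚ), localEulerPoincareCharacteristic (v.adicCompletion ℚ)) →
      poitouTate_sum_localTatePairing_eq_zero ℚ →
      ∀ (d : ℕ)
        (ι : (W.torsionGaloisModule (p : ℤ)).toContRepresentation →ⁱL
          (W.torsionGaloisModule ((p : ℤ) ^ (d + 1))).toContRepresentation),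
        (∀ P : geomTorsion W (p : ℤ),
          ((ι P : geomTorsion W ((p : ℤ) ^ (d + 1))) : geomPoints W) = (P : geomPoints W)) →
      ∀ (S₀ : Set (HeightOneSpectrum (𝓞 ℚ))), S₀.Finite →
      ∃ (ε : ℕ) (S : Set (HeightOneSpectrum (𝓞 ℚ))), S.Finite ∧ S₀ ⊆ S ∧
        ∀ (J : ℕ) (y : Literature.NumberTheory.EllipticCurves.subgroupH1 κ.kerSubgroup
            (geomTorsion W (p : ℤ))),
          (∃ t : W.fineSelmerInfty κ,
            W.torsionToPrimaryH1Sub p κ.kerSubgroup y = p ^ d • (t : W.subgroupH1 p κ.kerSubgroup)) →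
          (⇑(Literature.NumberTheory.EllipticCurves.conjH1 κ.kerSubgroup (geomTorsion W (p : ℤ)) γ -
            AddMonoidHom.id (Literature.NumberTheory.EllipticCurves.subgroupH1 κ.kerSubgroup
              (geomTorsion W (p : ℤ)))))^[J] y ≠ 0 →
          ∃ (Ψ : galoisCohomology (W.modPkTwist p (d + 1) κ.invTwist (J + 1)) 1)
            (ψb : galoisCohomology (W.modPTwist p κ.invTwist (J + 1)) 1),
            p ^ d • Ψ = galoisCohomology.map
              (κ.invTwist.twistModPToModPk (W.torsionGaloisModule (p : ℤ)) (J + 1)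
                (W.torsionGaloisModule ((p : ℤ) ^ (d + 1)))
                (fun P : geomTorsion W (p : ℤ) => AddSubgroup.torsionBy.nsmul P)
                (W.pow_nsmul_geomTorsion_eq_zero p (d + 1)) ι) 1 ψb ∧
            (κ.invTwist.shiftH1 (W.torsionGaloisModule (p : ℤ))
                (fun P : geomTorsion W (p : ℤ) => AddSubgroup.torsionBy.nsmul P) (J + 1))^[J] ψb ≠ 0 ∧
            (∀ v : HeightOneSpectrum (𝓞 ℚ), v ∉ S →
              galoisCohomology.localization (W.modPkTwist p (d + 1) κ.invTwist (J + 1)) (Sum.inr v) 1 Ψ ∈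
                DiscreteGaloisModule.unramifiedSubgroup
                  (GaloisRep.toLocal v (W.modPkTwist p (d + 1) κ.invTwist (J + 1))) 1) ∧
            (∀ v : HeightOneSpectrum (𝓞 ℚ), v ∈ S →
              galoisCohomology.localization (W.modPkTwist p (d + 1) κ.invTwist (J + 1)) (Sum.inr v) 1
                (galoisCohomology.map
                  (κ.invTwist.twistModPkShiftEmbed (W.torsionGaloisModule ((p : ℤ) ^ (d + 1)))
                    (W.pow_nsmul_geomTorsion_eq_zero p (d + 1)) (J + 1) (Nat.sub_le (J + 1) ε)) 1
                  (galoisCohomology.map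
                    (κ.invTwist.twistModPkTruncate (W.torsionGaloisModule ((p : ℤ) ^ (d + 1)))
                      (W.pow_nsmul_geomTorsion_eq_zero p (d + 1)) (J + 1) (Nat.sub_le (J + 1) ε)) 1 Ψ)) = 0))
    (h12 : ∀ (W : WeierstrassCurve ℚ) [W.IsElliptic] [W.IsGloballyMinimal] (p : ℕ) [Fact p.Prime]
      (κ : ZpExtension ℚ p) (γ : absoluteGaloisGroup ℚ) (d : ℕ),
      p ≠ 2 → W.HasGoodReductionAtPrime p → ¬ ((p : ℤ) ∣ W.frobeniusTrace p) →
      W.HasIrreducibleModPGaloisRep p → ¬ W.HasSurjectiveModNGaloisRep p →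
      κ.IsCyclotomic → κ.IsTopGenerator γ →
      ∃ c₀ N₁ : ℕ, ∀ (N : ℕ), N₁ ≤ N → ∀ (e' : ℕ), e' + 1 = p ^ N →
        ∀ (κ' : κ.twistTower (W.torsionGaloisModule (p : ℤ))
            (fun P : geomTorsion W (p : ℤ) => AddSubgroup.torsionBy.nsmul P)),
          κ.towerConst (W.torsionGaloisModule (p : ℤ)) (fun P => AddSubgroup.torsionBy.nsmul P) κ' ≠ 0 →
        ∀ (φ : contOneCocycles (W.modPTwist p κ (e' + 1)).toTopRep),
          oneCocycleClass (W.modPTwist p κ (e' + 1)).toTopRep φ = κ'.1 (e' + 1) →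
        ∀ (ψ : contOneCocycles (W.modPTwist p κ.invTwist (e' + 1)).toTopRep),
          (κ.invTwist.shiftH1 (W.torsionGaloisModule (p : ℤ))
            (fun P : geomTorsion W (p : ℤ) => AddSubgroup.torsionBy.nsmul P) (e' + 1))^[e']
              (oneCocycleClass (W.modPTwist p κ.invTwist (e' + 1)).toTopRep ψ) ≠ 0 →
        ∀ (eW : geomTorsion W (p : ℤ) → geomTorsion W (p : ℤ) → AlgebraicClosure ℚ)
          (hμ : ∀ S T, eW S T ^ p = 1) (hadd₁ : ∀ S₁ S₂ T, eW (S₁ + S₂) T = eW S₁ T * eW S₂ T)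
          (hadd₂ : ∀ S T₁ T₂, eW S (T₁ + T₂) = eW S T₁ * eW S T₂),
          (∀ T, (∀ S, eW S T = 1) → T = 0) →
        ∀ (S : Set (HeightOneSpectrum (𝓞 ℚ))), S.Finite →
        ∃ q : HeightOneSpectrum (𝓞 ℚ), q ∉ S ∧ ∃ 𝔓 ∈ q.primesAbove, ∃ Fr : absoluteGaloisGroup ℚ,
          IsArithFrobAt (𝓞 ℚ) Fr 𝔓 ∧ galoisRepTorsion W ((p : ℤ) ^ (d + 1)) Fr = 1 ∧
          Fr ∈ κ.layerSubgroup N ∧ Fr ∉ κ.layerSubgroup (N + 1) ∧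
          ∃ j : ℕ, j ≤ c₀ + 1 ∧ j < e' + 1 ∧
            convCoeff (weilPairingHom W p eW hμ hadd₁ hadd₂) (e' + 1) j (φ.1 Fr) (ψ.1 Fr) ≠ 0)
    (hG34 : ∀ (W : WeierstrassCurve ℚ) [W.IsElliptic] [W.IsGloballyMinimal] (p : ℕ) [Fact p.Prime]
      [ContinuousSMul ℤ_[p] (W.tateModule p)] [Module.Free ℤ_[p] (W.tateModule p)]
      [Module.Finite ℤ_[p] (W.tateModule p)]
      (κ : ZpExtension ℚ p) (γ : absoluteGaloisGroup ℚ) (I : IwasawaH1Data W p κ γ),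
      p ≠ 2 → W.HasIrreducibleModPGaloisRep p → ¬ W.HasSurjectiveModNGaloisRep p →
      κ.IsCyclotomic → κ.IsTopGenerator γ →
      poitouTate_sum_localTatePairing_eq_zero ℚ →
      ∀ (s : I.H), IsEulerSystemClass W p κ γ I s →
      ∀ (d : ℕ) (s' : I.H), s = ((PowerSeries.C (p : ℤ_[p]) : IwasawaAlgebra p) ^ d) • s' →
      ∃ (S₀ : Set (HeightOneSpectrum (𝓞 ℚ))), S₀.Finite ∧
        ∀ (a : ℕ) (κ' : κ.twistTower (W.torsionGaloisModule (p : ℤ))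
            (fun P : geomTorsion W (p : ℤ) => AddSubgroup.torsionBy.nsmul P)),
          (κ.towerShift (W.torsionGaloisModule (p : ℤ))
              (fun P : geomTorsion W (p : ℤ) => AddSubgroup.torsionBy.nsmul P))^[a] κ' = I.redTower s' →
          ∀ (N e' : ℕ), e' + 1 = p ^ N → d ≤ N →
          ∀ (Φ : contOneCocycles (W.modPTwist p κ (2 * e' + 1 + 1)).toTopRep),
            oneCocycleClass (W.modPTwist p κ (2 * e' + 1 + 1)).toTopRep Φ = κ'.1 (2 * e' + 1 + 1) →
          ∀ (J : ℕ), J + 1 = (2 * e' + 1 + 1) * (d + 1) → ∀ (hJe : 2 * e' + 1 + 1 ≤ J + 1),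
          ∀ (ε : ℕ) (S₁ : Set (HeightOneSpectrum (𝓞 ℚ)))
            (ι : (W.torsionGaloisModule (p : ℤ)).toContRepresentation →ⁱL
              (W.torsionGaloisModule ((p : ℤ) ^ (d + 1))).toContRepresentation),
            (∀ P : geomTorsion W (p : ℤ),
              ((ι P : geomTorsion W ((p : ℤ) ^ (d + 1))) : geomPoints W) = (P : geomPoints W)) →
          ∀ (Ψ : galoisCohomology (W.modPkTwist p (d + 1) κ.invTwist (J + 1)) 1)
            (ψb : galoisCohomology (W.modPTwist p κ.invTwist (J + 1)) 1)
            (Ψc : contOneCocycles (W.modPTwist p κ.invTwist (2 * e' + 1 + 1)).toTopRep),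
            S₀ ⊆ S₁ →
            oneCocycleClass (W.modPTwist p κ.invTwist (2 * e' + 1 + 1)).toTopRep Ψc =
              κ.invTwist.truncH1 (W.torsionGaloisModule (p : ℤ))
                (fun P : geomTorsion W (p : ℤ) => AddSubgroup.torsionBy.nsmul P) hJe ψb →
            p ^ d • Ψ = galoisCohomology.map
              (κ.invTwist.twistModPToModPk (W.torsionGaloisModule (p : ℤ)) (J + 1)
                (W.torsionGaloisModule ((p : ℤ) ^ (d + 1)))
                (fun P : geomTorsion W (p : ℤ) => AddSubgroup.torsionBy.nsmul P)
                (W.pow_nsmul_geomTorsion_eq_zero p (d + 1)) ι) 1 ψb →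
            (κ.invTwist.shiftH1 (W.torsionGaloisModule (p : ℤ))
                (fun P : geomTorsion W (p : ℤ) => AddSubgroup.torsionBy.nsmul P) (J + 1))^[J] ψb ≠ 0 →
            (∀ v : HeightOneSpectrum (𝓞 ℚ), v ∉ S₁ →
              galoisCohomology.localization (W.modPkTwist p (d + 1) κ.invTwist (J + 1)) (Sum.inr v) 1 Ψ ∈
                DiscreteGaloisModule.unramifiedSubgroup
                  (GaloisRep.toLocal v (W.modPkTwist p (d + 1) κ.invTwist (J + 1))) 1) →
            (∀ v : HeightOneSpectrum (𝓞 ℚ), v ∈ S₁ →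
              galoisCohomology.localization (W.modPkTwist p (d + 1) κ.invTwist (J + 1)) (Sum.inr v) 1
                (galoisCohomology.map
                  (κ.invTwist.twistModPkShiftEmbed (W.torsionGaloisModule ((p : ℤ) ^ (d + 1)))
                    (W.pow_nsmul_geomTorsion_eq_zero p (d + 1)) (J + 1) (Nat.sub_le (J + 1) ε)) 1
                  (galoisCohomology.map
                    (κ.invTwist.twistModPkTruncate (W.torsionGaloisModule ((p : ℤ) ^ (d + 1)))
                      (W.pow_nsmul_geomTorsion_eq_zero p (d + 1)) (J + 1) (Nat.sub_le (J + 1) ε)) 1 Ψ)) = 0) →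
          ∀ (eW : geomTorsion W (p : ℤ) → geomTorsion W (p : ℤ) → AlgebraicClosure ℚ)
            (hμ : ∀ S T, eW S T ^ p = 1)
            (hadd₁ : ∀ S₁' S₂' T, eW (S₁' + S₂') T = eW S₁' T * eW S₂' T)
            (hadd₂ : ∀ S T₁ T₂, eW S (T₁ + T₂) = eW S T₁ * eW S T₂),
            (∀ T, eW T T = 1) → (∀ T, (∀ S, eW S T = 1) → T = 0) →
            (∀ (σ : absoluteGaloisGroup ℚ) (S T : geomTorsion W (p : ℤ)), σ • eW S T = eW (σ • S) (σ • T)) →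
          ∀ (q : HeightOneSpectrum (𝓞 ℚ)), q ∉ S₁ →
          ∀ 𝔓 ∈ q.primesAbove, ∀ (Fr : absoluteGaloisGroup ℚ), IsArithFrobAt (𝓞 ℚ) Fr 𝔓 →
            galoisRepTorsion W ((p : ℤ) ^ (d + 1)) Fr = 1 →
            Fr ∈ κ.layerSubgroup N → Fr ∉ κ.layerSubgroup (N + 1) →
          ∃ U : Polynomial ℤ, ¬ ((p : ℤ) ∣ U.coeff 0) ∧
            ∀ i : ℕ, i + ε < 2 * e' + 1 + 1 →
              convCoeff (weilPairingHom W p eW hμ hadd₁ hadd₂) (2 * e' + 1 + 1) i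
                (Polynomial.aeval (shiftEnd (geomTorsion W (p : ℤ)) (2 * e' + 1 + 1)) U
                  ((shiftEnd (geomTorsion W (p : ℤ)) (2 * e' + 1 + 1) ^ (e' + 1 + a)) (Φ.1 Fr)))
                (Ψc.1 Fr) = 0) :
    FineCoreGradedOddPrime := by
  intro W _ _ p _ _ _ _ κ γ I n hp2 hgood hap hirr hns hκ hγ hs
  obtain ⟨s, hES, hsp⟩ := hs
  have hp : p.Prime := Fact.out
  haveI : Finite (geomTorsion W (p : ℤ)) :=
    WeierstrassCurve.finite_torsionPoints_holds W (AlgebraicClosure ℚ) (by exact_mod_cast hp.ne_zero)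
  -- STEP 0ᵍ: `s = p^d s'`, `d ≤ n`, `s' ∉ p𝐇¹`; `red_Ω s' = T^a κ'`, `κ̄' ≠ 0`
  obtain ⟨d, hdn, s', hss', hs'p⟩ := exists_eq_C_pow_smul_and_not_mem hsp
  have ht : I.redTower s' ≠ 0 := I.redTower_ne_zero_of_not_mem hred hκ hγ hs'p
  obtain ⟨a, κ', hκ'a, -, hκ'c⟩ :=
    LevelE.exists_towerShift_iterate_eq_and_towerConst_ne_zero W p κ hirr ht
  -- the inclusion `ι : E[p] ⊂ E[p^{d+1}]` as an equivariant continuous map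
  have hle_tors : geomTorsion W (p : ℤ) ≤ geomTorsion W ((p : ℤ) ^ (d + 1)) := by
    intro P hP
    simp only [Submodule.mem_toAddSubgroup, Submodule.mem_torsionBy_iff] at hP ⊢
    rw [pow_succ, mul_smul, hP, smul_zero]
  obtain ⟨ι, hι⟩ : ∃ ι : (W.torsionGaloisModule (p : ℤ)).toContRepresentation →ⁱL
      (W.torsionGaloisModule ((p : ℤ) ^ (d + 1))).toContRepresentation,
      ∀ P : geomTorsion W (p : ℤ),
        ((ι P : geomTorsion W ((p : ℤ) ^ (d + 1))) : geomPoints W) = (P : geomPoints W) := by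
    refine ⟨{ toContinuousLinearMap :=
                { toFun := fun P => AddSubgroup.inclusion hle_tors P,
                  map_add' := fun P Q => map_add _ P Q,
                  map_smul' := fun c P => by rw [map_zsmul, RingHom.id_apply],
                  cont := continuous_of_discreteTopology },
              isIntertwining' := fun g => ?_ }, fun P => rfl⟩
    refine ContinuousLinearMap.ext fun P => Subtype.ext ?_
    change (((W.torsionGaloisModule (p : ℤ)) g P : geomTorsion W (p : ℤ)) : geomPoints W) =
      (((W.torsionGaloisModule ((p : ℤ) ^ (d + 1))) g (AddSubgroup.inclusion hle_tors P) :
        geomTorsion W ((p : ℤ) ^ (d + 1))) : geomPoints W)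
    simp only [torsionGaloisModule_apply_apply,
      Literature.NumberTheory.EllipticCurves.AddSubgroup.torsionBy.coe_smul, AddSubgroup.coe_inclusion]
  -- Steps 3–4ᵍ: the bad set `S₀` of the Euler system
  obtain ⟨S₀, hS₀, hG34'⟩ := hG34 W p κ γ I hp2 hirr hns hκ hγ hPT s hES d s' hss'
  -- the Selmer sideᵍ at level `d`: `ε`, `S₁ ⊇ S₀`
  obtain ⟨ε, S₁, hS₁, hS₀₁, hG1'⟩ := hG1 W p κ γ hp2 hirr hns hκ hγ hEP hPT d ι hι S₀ hS₀
  -- STEP 1+2ᵍ constants `c₀`, `N₁`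
  obtain ⟨c₀, N₁, h12'⟩ := h12 W p κ γ d hp2 hgood hap hirr hns hκ hγ
  clear hG1 h12 hG34
  -- a Weil pairing on `E[p]`
  obtain ⟨eW, hμ, hadd₁, hadd₂, halt, hnondeg, hgal⟩ :=
    W.exists_weilPairing_holds p hp.two_le (Nat.cast_ne_zero.mpr hp.ne_zero)
  -- suppose the conclusion fails: test classes of arbitrarily large `T`-order
  by_contra hcon
  push Not at hcon
  -- the level `e = e' + 1 = p^N`, `N ≥ N₁`, `N ≥ d`, `e > a + ε + c₀ + 1`
  set N : ℕ := a + ε + c₀ + 2 + N₁ + d with hN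
  have hlt : a + ε + c₀ + 2 + N₁ + d < p ^ N := Nat.lt_pow_self hp.one_lt
  obtain ⟨e', he⟩ : ∃ e' : ℕ, e' + 1 = p ^ N := ⟨p ^ N - 1, by omega⟩
  have he1 : 1 < e' + 1 := by
    have : p ≤ p ^ N := Nat.le_self_pow (by omega) p
    have := hp.two_le
    omega
  -- the big level `L = Jb + 1 = 2e·(d+1)` (so that `T^L ∈ (p^{d+1}, ω²)`) and the bad class `y` with `T^{Jb} y ≠ 0`,
  -- converted to a level-`d` test pair
  have hLpos : 1 ≤ (2 * e' + 1 + 1) * (d + 1) := Nat.one_le_iff_ne_zero.mpr (Nat.mul_ne_zero (by omega) (by omega))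
  obtain ⟨Jb, hJb⟩ : ∃ Jb : ℕ, Jb + 1 = (2 * e' + 1 + 1) * (d + 1) :=
    ⟨(2 * e' + 1 + 1) * (d + 1) - 1, Nat.sub_add_cancel hLpos⟩
  have hJe : 2 * e' + 1 + 1 ≤ Jb + 1 := by
    rw [hJb]
    exact Nat.le_mul_of_pos_right _ (by omega)
  obtain ⟨y, ⟨t, hyt⟩, hyT⟩ := hcon Jb
  have hyt' : ∃ t' : W.fineSelmerInfty κ,
      W.torsionToPrimaryH1Sub p κ.kerSubgroup y = p ^ d • (t' : W.subgroupH1 p κ.kerSubgroup) := by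
    refine ⟨p ^ (n - d) • t, ?_⟩
    rw [hyt, AddSubmonoidClass.coe_nsmul, ← mul_smul, ← pow_add, Nat.add_sub_cancel' hdn]
  obtain ⟨Ψ, ψb, hΨψ, hψT, hΨur, hΨε⟩ := hG1' Jb y hyt' hyT
  obtain ⟨ΨcL, hΨcL⟩ := oneCocycleClass_surjective _ ψb
  subst hΨcL
  -- the truncation `Ψc` of the mod-`p` class to level `2e`, of full `T`-order there
  let Ψc : contOneCocycles (W.modPTwist p κ.invTwist (2 * e' + 1 + 1)).toTopRep :=
    κ.invTwist.pushCocycle (W.torsionGaloisModule (p : ℤ))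
      (fun P : geomTorsion W (p : ℤ) => AddSubgroup.torsionBy.nsmul P) (Jb + 1)
      (κ.invTwist.twistModPTruncate (W.torsionGaloisModule (p : ℤ)) _ (Jb + 1) hJe) ΨcL
  have hΨcclass : oneCocycleClass (W.modPTwist p κ.invTwist (2 * e' + 1 + 1)).toTopRep Ψc =
      κ.invTwist.truncH1 (W.torsionGaloisModule (p : ℤ))
        (fun P : geomTorsion W (p : ℤ) => AddSubgroup.torsionBy.nsmul P) hJe
        (oneCocycleClass (W.modPTwist p κ.invTwist (Jb + 1)).toTopRep ΨcL) :=
    (ZpExtension.map_oneCocycleClass_twist κ.invTwist (W.torsionGaloisModule (p : ℤ)) _ (Jb + 1)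
      (κ.invTwist.twistModPTruncate (W.torsionGaloisModule (p : ℤ)) _ (Jb + 1) hJe) ΨcL).symm
  have hΨT2e : (κ.invTwist.shiftH1 (W.torsionGaloisModule (p : ℤ))
      (fun P : geomTorsion W (p : ℤ) => AddSubgroup.torsionBy.nsmul P) (2 * e' + 1 + 1))^[2 * e' + 1]
        (oneCocycleClass (W.modPTwist p κ.invTwist (2 * e' + 1 + 1)).toTopRep Ψc) ≠ 0 := by
    have h := shiftH1_iterate_truncate_ne_zero_of_le κ.invTwist (W.torsionGaloisModule (p : ℤ)) _ hJe
      (k := Jb) (by omega) ΨcL hψT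
    rwa [show Jb - (Jb + 1 - (2 * e' + 1 + 1)) = 2 * e' + 1 by omega] at h
  -- a cocycle `Φ` of `κ'_{2e}`
  obtain ⟨Φ, hΦ⟩ := oneCocycleClass_surjective _ (κ'.1 (2 * e' + 1 + 1))
  -- truncations to level `e = e' + 1`
  have hle : e' + 1 ≤ 2 * e' + 1 + 1 := by omega
  let φ : contOneCocycles (W.modPTwist p κ (e' + 1)).toTopRep :=
    κ.pushCocycle (W.torsionGaloisModule (p : ℤ))
      (fun P : geomTorsion W (p : ℤ) => AddSubgroup.torsionBy.nsmul P) (2 * e' + 1 + 1)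
      (κ.twistModPTruncate (W.torsionGaloisModule (p : ℤ)) _ (2 * e' + 1 + 1) hle) Φ
  let ψ : contOneCocycles (W.modPTwist p κ.invTwist (e' + 1)).toTopRep :=
    κ.invTwist.pushCocycle (W.torsionGaloisModule (p : ℤ))
      (fun P : geomTorsion W (p : ℤ) => AddSubgroup.torsionBy.nsmul P) (2 * e' + 1 + 1)
      (κ.invTwist.twistModPTruncate (W.torsionGaloisModule (p : ℤ)) _ (2 * e' + 1 + 1) hle) Ψc
  have hφ : oneCocycleClass (W.modPTwist p κ (e' + 1)).toTopRep φ = κ'.1 (e' + 1) := by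
    have h1 := (κ.mem_twistTower_iff (W.torsionGaloisModule (p : ℤ)) _ κ'.1).1 κ'.2 _ _ hle
    rw [← hΦ] at h1
    exact (ZpExtension.map_oneCocycleClass_twist κ (W.torsionGaloisModule (p : ℤ)) _ (2 * e' + 1 + 1)
      (κ.twistModPTruncate (W.torsionGaloisModule (p : ℤ)) _ (2 * e' + 1 + 1) hle) Φ).symm.trans h1
  have hψT' : (κ.invTwist.shiftH1 (W.torsionGaloisModule (p : ℤ))
      (fun P : geomTorsion W (p : ℤ) => AddSubgroup.torsionBy.nsmul P) (e' + 1))^[e']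
        (oneCocycleClass (W.modPTwist p κ.invTwist (e' + 1)).toTopRep ψ) ≠ 0 :=
    shiftH1_iterate_truncate_ne_zero κ.invTwist (W.torsionGaloisModule (p : ℤ)) _ e' Ψc hΨT2e hle
  -- STEP 1+2ᵍ (stub): an `E[p^{d+1}]`-split prime `q ∉ S₁` of depth `N` with a Frobenius at which a low
  -- convolution coefficient of `(φ, ψ)` does not vanish
  haveI : NeZero p := ⟨hp.ne_zero⟩
  obtain ⟨q, hq, 𝔓, h𝔓, Fr, hFr, hFr1, hFrn, hFrn1, j, hjc, hje, hCj⟩ :=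
    h12' N (by omega) e' he κ' hκ'c φ hφ ψ hψT' eW hμ hadd₁ hadd₂ hnondeg S₁ hS₁
  -- STEPS 3–4ᵍ (stub): the Kolyvagin class over `A` and reciprocity at `q`
  obtain ⟨U, hU0, hrec⟩ := hG34' a κ' hκ'a N e' he (by omega) Φ hΦ Jb hJb hJe ε S₁ ι hι Ψ _ Ψc hS₀₁
    hΨcclass hΨψ hψT hΨur hΨε eW hμ hadd₁ hadd₂ halt hnondeg hgal q hq 𝔓 h𝔓 Fr hFr hFr1 hFrn hFrn1
  -- the count with defect `c₀ + 1`: `C_j = 0` for all `j ≤ c₀ + 1` of the level-`2e` pair `(Φ(Fr), Ψc(Fr))`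
  have hpC : ∀ c : DiscreteGaloisModule.MuCarrier ℚ p, (p : ℤ) • c = 0 :=
    natCast_zsmul_muCarrier_eq_zero ℚ p
  have hall := convCoeff_eq_zero_of_reciprocity_le (weilPairingHom W p eW hμ hadd₁ hadd₂) hp hpC
    (m := e' + 1 + a) (r := c₀ + 1) (ε := ε) (by omega) U hU0 (Φ.1 Fr) (Ψc.1 Fr) hrec
  have hCj0 : convCoeff (weilPairingHom W p eW hμ hadd₁ hadd₂) (2 * e' + 1 + 1) j (Φ.1 Fr) (Ψc.1 Fr) = 0 :=
    hall j hjc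
  -- the coefficients of index `< e` of the level-`2e` pair are those of the level-`e` pair `(φ(Fr), ψ(Fr))`
  have htr : convCoeff (weilPairingHom W p eW hμ hadd₁ hadd₂) (e' + 1) j (φ.1 Fr) (ψ.1 Fr) =
      convCoeff (weilPairingHom W p eW hμ hadd₁ hadd₂) (2 * e' + 1 + 1) j (Φ.1 Fr) (Ψc.1 Fr) :=
    convCoeff_eq_of_apply_castLE_eq (weilPairingHom W p eW hμ hadd₁ hadd₂) hle hje (Φ.1 Fr) (Ψc.1 Fr)
      (φ.1 Fr) (ψ.1 Fr) (fun _ => rfl) (fun _ => rfl)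
  exact hCj (htr.trans hCj0)

end Summit.BirchSwinnertonDyer.BirchSwinnertonDyer.Theorems.OneSidedTwistSqueezeX9KatoDivisibilityX9GradedCoreAssembly

end
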